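import Summits.HubbardSuperconductivity.HubbardSuperconductivity.Theorems.WeakCouplingBCSKlLindhardEnclosureCeilRulesOrd
import Summits.HubbardSuperconductivity.HubbardSuperconductivity.Theorems.WeakCouplingBCSKlLindhardEnclosureCellSound

/-!
# KL-MARGIN-SCAN reader (22) «kernel-lindhard-enclosure» — the SAME-SIDE ceiling rule DISCHARGED

First of the seven rule-level debts of the instrument paid in full: for EVERY parameter record `P`, the oriented rule predicate
`SameSideZeroOrd P` of `…CeilRulesOrd` HOLDS (a guarded, oriented cell inside the root square whose two shell statuses are certified equal
carries no mass), by `…CellSound.sameSide_ceilValid_zero` (records soundness: point cosine records, range tests, antitonicity guards, status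
flags ⇒ the two-shell integrand vanishes on the cell).  Hence the remaining CEILING debt of `CeilSoundAt P t` (all trees) is exactly the four
rules `CeilCrudeSoundOrd`, `CeilChordSoundOrd`, `CeilBdrySoundOrd`, `CeilTipSoundOrd` (`ceilSoundAt_of_four_rules`).  Honest framing: nothing
in this file asserts a KL margin at any `t′ ≠ 0`, `K₃`, `U₀`, the window or B1g dominance; a Kohn–Luttinger instability statement is not
ODLRO and nothing here proves superconductivity in the Hubbard model.  (p1 g25, 2026-08-29.)
-/

noncomputable section

set_option linter.dupNamespace false

namespace Summit.HubbardSuperconductivity.HubbardSuperconductivity.Theorems.KlLindhardEnclosure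

open Real Set MeasureTheory Literature.MathematicalPhysics.QuantumLattice
open Summit.HubbardSuperconductivity.HubbardSuperconductivity.Theorems

/-- **THE SAME-SIDE RULE HOLDS for every `P`.** -/
theorem sameSideZeroOrd (P : Params) : SameSideZeroOrd P := by
  intro a b c d k hP hin _hab _hcd hg hs1 hs2
  exact P.sameSide_ceilValid_zero hP hin.1 hin.2.2.2.1 hin.2.2.2.2.1 hin.2.2.2.2.2.2.2 hg k hs1 hs2

/-- **CEILING SOUNDNESS FROM THE FOUR REMAINING RULES** (crude, chord, majorised hyperbola, tip), for every certificate tree. -/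
theorem ceilSoundAt_of_four_rules (P : Params) (hCr : CeilCrudeSoundOrd P) (hCh : CeilChordSoundOrd P) (hB : CeilBdrySoundOrd P)
    (hT : CeilTipSoundOrd P) (t : QB) : CeilSoundAt P t :=
  ceilSoundAt_of_rulesOrd P (sameSideZeroOrd P) hCr hCh hB hT t

end Summit.HubbardSuperconductivity.HubbardSuperconductivity.Theorems.KlLindhardEnclosure

end
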